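import Summits.ValiantsHypothesis.ValiantsHypothesis.Theorems.SymPencilPerFourToricStabilizer

/-!
# Route `SymPencil` — the toric pencil of `per [w; ·]` over a coordinate hyperplane is trivial
# (tool for the TORIC sub-case of the cell `(13, 3, 0)` of `sdc(per_4)`; `--supports`
# stmt-ValiantsHypothesis-5674, rung currency only, nothing here bears on `VP ≠ VNP`)

Pure permanent algebra over a field of characteristic `0`, on `3 × 4` matrices
`x = (x 0, x 1, x 2)` (rows) with `F_w(x) = per [w; x 0; x 1; x 2]`.

* `no_linear_syzygy`: the three permanental `2 × 2` minors `per₂(x; rows ≠ a; cols {p, q})` of a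
  `3 × 2` block admit NO syzygy with linear-form coefficients (they form a regular sequence):
  `Σ_a ℓ_a(x) per₂(x; rows ≠ a; cols {p,q}) ≡ 0` with `ℓ_a` linear forces `ℓ_a = 0`.
* `toric_pencil_eq_zero`: if linear maps `K₀, K₁, K₂` satisfy
  `F_w(x + t · (w₀ K₀ x + w₁ K₁ x + w₂ K₂ x)) = F_w(x)` for every `w` with `w₃ = 0` and all `x, t`,
  then `K₀ = K₁ = K₂ = 0`.  Proof: at `w = e_k` the pencil stabilises `per [e_k; ·]`, so `K_k x` is
  supported on the column `k` (`SymPencilPerFourToricStabilizer.col_support_of_pencil`); at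
  `w = e_m + e_q` the `t`-coefficient is the syzygy `Σ_a (κ_{m,a} + κ_{q,a}) per₂(rows ≠ a; cols {p,3})`
  (`p` the fourth index), so `κ_m + κ_q = 0` for the three pairs, whence all `κ = 0`.

This is the algebraic heart of the toric sub-case of cell `(13, 3, 0)`
(`SymPencilSdcPerFourCellThirteenThreeToric`). [folklore]
-/

noncomputable section

-- single-conjunct layout: Sub = Summit, duplicated namespace component intended
set_option linter.dupNamespace false

namespace Summit.ValiantsHypothesis.ValiantsHypothesis.Theorems.SymPencilPerFourToricPairs

open Matrix
open Summit.ValiantsHypothesis.ValiantsHypothesis.Theorems.SymPencilPerFourInnerRankRows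
open Summit.ValiantsHypothesis.ValiantsHypothesis.Theorems.SymPencilPerFourRowForms
open Summit.ValiantsHypothesis.ValiantsHypothesis.Theorems.SymPencilPerFourToricStabilizer

variable {K : Type*} [Field K]

/-! ### No linear syzygy among the permanental minors of a `3 × 2` block -/

/-- **No linear syzygy.**  See the module docstring. [folklore] -/
theorem no_linear_syzygy [CharZero K] (p q : Fin 4) (hpq : p ≠ q)
    (ℓ : Fin 3 → ((Fin 3 → Fin 4 → K) →ₗ[K] K))
    (h : ∀ x : Fin 3 → Fin 4 → K,
      ℓ 0 x * (x 1 p * x 2 q + x 1 q * x 2 p) + ℓ 1 x * (x 0 p * x 2 q + x 0 q * x 2 p) +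
        ℓ 2 x * (x 0 p * x 1 q + x 0 q * x 1 p) = 0) :
    ∀ a, ℓ a = 0 := by
  classical
  have hqp : q ≠ p := fun h' => hpq h'.symm
  -- column embeddings
  let colP : (Fin 3 → K) →ₗ[K] (Fin 3 → Fin 4 → K) :=
    { toFun := fun u d n => if n = p then u d else 0
      map_add' := fun u v => by funext d n; simp only [Pi.add_apply]; split_ifs <;> simp
      map_smul' := fun c u => by
        funext d n; simp only [Pi.smul_apply, smul_eq_mul, RingHom.id_apply]; split_ifs <;> simp }
  have hP : ∀ u d n, colP u d n = if n = p then u d else 0 := fun _ _ _ => rfl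
  let colQ : (Fin 3 → K) →ₗ[K] (Fin 3 → Fin 4 → K) :=
    { toFun := fun u d n => if n = q then u d else 0
      map_add' := fun u v => by funext d n; simp only [Pi.add_apply]; split_ifs <;> simp
      map_smul' := fun c u => by
        funext d n; simp only [Pi.smul_apply, smul_eq_mul, RingHom.id_apply]; split_ifs <;> simp }
  have hQ : ∀ u d n, colQ u d n = if n = q then u d else 0 := fun _ _ _ => rfl
  have hPp : ∀ u d, colP u d p = u d := fun u d => by rw [hP, if_pos rfl]
  have hPq : ∀ u d, colP u d q = 0 := fun u d => by rw [hP, if_neg hqp]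
  have hQq : ∀ u d, colQ u d q = u d := fun u d => by rw [hQ, if_pos rfl]
  have hQp : ∀ u d, colQ u d p = 0 := fun u d => by rw [hQ, if_neg hpq]
  -- (1) the `u`-part and the `v`-part of the identity
  have hAB : ∀ u v : Fin 3 → K,
      (ℓ 0 (colP u) * (u 1 * v 2 + v 1 * u 2) + ℓ 1 (colP u) * (u 0 * v 2 + v 0 * u 2) +
        ℓ 2 (colP u) * (u 0 * v 1 + v 0 * u 1) = 0) ∧
      (ℓ 0 (colQ v) * (u 1 * v 2 + v 1 * u 2) + ℓ 1 (colQ v) * (u 0 * v 2 + v 0 * u 2) +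
        ℓ 2 (colQ v) * (u 0 * v 1 + v 0 * u 1) = 0) := by
    intro u v
    have key : ∀ r : K, h (colP u + colQ (r • v)) = h (colP u + colQ (r • v)) := fun r => rfl
    have e : ∀ r : K,
        r * (ℓ 0 (colP u) * (u 1 * v 2 + v 1 * u 2) + ℓ 1 (colP u) * (u 0 * v 2 + v 0 * u 2) +
          ℓ 2 (colP u) * (u 0 * v 1 + v 0 * u 1)) +
        r ^ 2 * (ℓ 0 (colQ v) * (u 1 * v 2 + v 1 * u 2) + ℓ 1 (colQ v) * (u 0 * v 2 + v 0 * u 2) +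
          ℓ 2 (colQ v) * (u 0 * v 1 + v 0 * u 1)) = 0 := by
      intro r
      have h1 := h (colP u + colQ (r • v))
      simp only [map_add, map_smul, smul_eq_mul, Pi.add_apply, Pi.smul_apply, hPp, hPq, hQq,
        hQp, zero_add] at h1
      linear_combination h1
    have f1 := e 1
    have f2 := e 2
    constructor
    · linear_combination 2 * f1 - f2 / 2
    · linear_combination f2 / 2 - f1
  -- (2) the `u`-part vanishes on the column `p`
  have hA : ∀ a (u : Fin 3 → K), ℓ a (colP u) = 0 := by
    have hS : ∀ u v : Fin 3 → K,
        ℓ 0 (colP u) * (u 1 * v 2 + v 1 * u 2) + ℓ 1 (colP u) * (u 0 * v 2 + v 0 * u 2) +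
          ℓ 2 (colP u) * (u 0 * v 1 + v 0 * u 1) = 0 := fun u v => (hAB u v).1
    -- relations from `v = e_d`
    have r0 : ∀ u : Fin 3 → K, ℓ 1 (colP u) * u 2 + ℓ 2 (colP u) * u 1 = 0 := fun u => by
      have h1 := hS u (Pi.single 0 1); simp at h1; linear_combination h1
    have r1 : ∀ u : Fin 3 → K, ℓ 0 (colP u) * u 2 + ℓ 2 (colP u) * u 0 = 0 := fun u => by
      have h1 := hS u (Pi.single 1 1); simp at h1; linear_combination h1
    have r2 : ∀ u : Fin 3 → K, ℓ 0 (colP u) * u 1 + ℓ 1 (colP u) * u 0 = 0 := fun u => by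
      have h1 := hS u (Pi.single 2 1); simp at h1; linear_combination h1
    -- values on the coordinate vectors
    have v10 : ℓ 1 (colP (Pi.single 0 1)) = 0 ∧ ℓ 1 (colP (Pi.single 2 1)) = 0 := by
      have a := r0 (Pi.single 2 1); have b := r0 ((Pi.single 2 1) + (Pi.single 0 1))
      simp at a b
      exact ⟨by linear_combination b - a, a⟩
    have v20 : ℓ 2 (colP (Pi.single 0 1)) = 0 ∧ ℓ 2 (colP (Pi.single 1 1)) = 0 := by
      have a := r0 (Pi.single 1 1); have b := r0 ((Pi.single 1 1) + (Pi.single 0 1))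
      simp at a b
      exact ⟨by linear_combination b - a, a⟩
    have v01 : ℓ 0 (colP (Pi.single 1 1)) = 0 ∧ ℓ 0 (colP (Pi.single 2 1)) = 0 := by
      have a := r1 (Pi.single 2 1); have b := r1 ((Pi.single 2 1) + (Pi.single 1 1))
      simp at a b
      exact ⟨by linear_combination b - a, a⟩
    have d0 : ℓ 1 (colP (Pi.single 1 1)) + ℓ 2 (colP (Pi.single 2 1)) = 0 := by
      have a := r0 ((Pi.single 1 1) + (Pi.single 2 1))
      simp at a
      linear_combination a - v10.2 - v20.2
    have d1 : ℓ 0 (colP (Pi.single 0 1)) + ℓ 2 (colP (Pi.single 2 1)) = 0 := by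
      have a := r1 ((Pi.single 0 1) + (Pi.single 2 1))
      simp at a
      linear_combination a - v01.2 - v20.1
    have d2 : ℓ 0 (colP (Pi.single 0 1)) + ℓ 1 (colP (Pi.single 1 1)) = 0 := by
      have a := r2 ((Pi.single 0 1) + (Pi.single 1 1))
      simp at a
      linear_combination a - v01.1 - v10.1
    have hall : ∀ a k : Fin 3, ℓ a (colP (Pi.single k 1)) = 0 := by
      intro a k
      fin_cases a <;> fin_cases k
      · show ℓ 0 (colP (Pi.single 0 1)) = 0; linear_combination (d1 + d2 - d0) / 2
      · exact v01.1
      · exact v01.2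
      · exact v10.1
      · show ℓ 1 (colP (Pi.single 1 1)) = 0; linear_combination (d0 + d2 - d1) / 2
      · exact v10.2
      · exact v20.1
      · exact v20.2
      · show ℓ 2 (colP (Pi.single 2 1)) = 0; linear_combination (d0 + d1 - d2) / 2
    intro a u
    have hu : u = ∑ k, u k • (Pi.single k 1 : Fin 3 → K) := by
      funext d; simp [Finset.sum_apply, Pi.single_apply]
    rw [hu, map_sum, map_sum]
    exact Finset.sum_eq_zero fun k _ => by rw [map_smul, map_smul, smul_eq_mul, hall, mul_zero]
  -- (3) the `v`-part vanishes on the column `q` (same argument)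
  have hB : ∀ a (v : Fin 3 → K), ℓ a (colQ v) = 0 := by
    have hS : ∀ u v : Fin 3 → K,
        ℓ 0 (colQ v) * (u 1 * v 2 + v 1 * u 2) + ℓ 1 (colQ v) * (u 0 * v 2 + v 0 * u 2) +
          ℓ 2 (colQ v) * (u 0 * v 1 + v 0 * u 1) = 0 := fun u v => (hAB u v).2
    have r0 : ∀ v : Fin 3 → K, ℓ 1 (colQ v) * v 2 + ℓ 2 (colQ v) * v 1 = 0 := fun v => by
      have h1 := hS (Pi.single 0 1) v; simp at h1; linear_combination h1
    have r1 : ∀ v : Fin 3 → K, ℓ 0 (colQ v) * v 2 + ℓ 2 (colQ v) * v 0 = 0 := fun v => by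
      have h1 := hS (Pi.single 1 1) v; simp at h1; linear_combination h1
    have r2 : ∀ v : Fin 3 → K, ℓ 0 (colQ v) * v 1 + ℓ 1 (colQ v) * v 0 = 0 := fun v => by
      have h1 := hS (Pi.single 2 1) v; simp at h1; linear_combination h1
    have v10 : ℓ 1 (colQ (Pi.single 0 1)) = 0 ∧ ℓ 1 (colQ (Pi.single 2 1)) = 0 := by
      have a := r0 (Pi.single 2 1); have b := r0 ((Pi.single 2 1) + (Pi.single 0 1))
      simp at a b
      exact ⟨by linear_combination b - a, a⟩
    have v20 : ℓ 2 (colQ (Pi.single 0 1)) = 0 ∧ ℓ 2 (colQ (Pi.single 1 1)) = 0 := by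
      have a := r0 (Pi.single 1 1); have b := r0 ((Pi.single 1 1) + (Pi.single 0 1))
      simp at a b
      exact ⟨by linear_combination b - a, a⟩
    have v01 : ℓ 0 (colQ (Pi.single 1 1)) = 0 ∧ ℓ 0 (colQ (Pi.single 2 1)) = 0 := by
      have a := r1 (Pi.single 2 1); have b := r1 ((Pi.single 2 1) + (Pi.single 1 1))
      simp at a b
      exact ⟨by linear_combination b - a, a⟩
    have d0 : ℓ 1 (colQ (Pi.single 1 1)) + ℓ 2 (colQ (Pi.single 2 1)) = 0 := by
      have a := r0 ((Pi.single 1 1) + (Pi.single 2 1))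
      simp at a
      linear_combination a - v10.2 - v20.2
    have d1 : ℓ 0 (colQ (Pi.single 0 1)) + ℓ 2 (colQ (Pi.single 2 1)) = 0 := by
      have a := r1 ((Pi.single 0 1) + (Pi.single 2 1))
      simp at a
      linear_combination a - v01.2 - v20.1
    have d2 : ℓ 0 (colQ (Pi.single 0 1)) + ℓ 1 (colQ (Pi.single 1 1)) = 0 := by
      have a := r2 ((Pi.single 0 1) + (Pi.single 1 1))
      simp at a
      linear_combination a - v01.1 - v10.1
    have hall : ∀ a k : Fin 3, ℓ a (colQ (Pi.single k 1)) = 0 := by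
      intro a k
      fin_cases a <;> fin_cases k
      · show ℓ 0 (colQ (Pi.single 0 1)) = 0; linear_combination (d1 + d2 - d0) / 2
      · exact v01.1
      · exact v01.2
      · exact v10.1
      · show ℓ 1 (colQ (Pi.single 1 1)) = 0; linear_combination (d0 + d2 - d1) / 2
      · exact v10.2
      · exact v20.1
      · exact v20.2
      · show ℓ 2 (colQ (Pi.single 2 1)) = 0; linear_combination (d0 + d1 - d2) / 2
    intro a v
    have hv : v = ∑ k, v k • (Pi.single k 1 : Fin 3 → K) := by
      funext d; simp [Finset.sum_apply, Pi.single_apply]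
    rw [hv, map_sum, map_sum]
    exact Finset.sum_eq_zero fun k _ => by rw [map_smul, map_smul, smul_eq_mul, hall, mul_zero]
  -- (4) the other columns
  have hC : ∀ a (d : Fin 3) (n : Fin 4), n ≠ p → n ≠ q →
      ℓ a (Pi.single d (Pi.single n 1)) = 0 := by
    intro a d n hnp hnq
    -- the isolating test matrix for `a`
    obtain ⟨b, c, htest⟩ : ∃ b c : Fin 3, ∀ y : Fin 3 → Fin 4 → K,
        (∀ d', y d' p = 0) → (∀ d', y d' q = 0) →
        ℓ a (colP (Pi.single b 1)) + ℓ a (colQ (Pi.single c 1)) + ℓ a y = 0 := by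
      have h3 : a = 0 ∨ a = 1 ∨ a = 2 := by
        rcases a with ⟨_ | _ | _ | n, hn⟩
        · exact Or.inl rfl
        · exact Or.inr (Or.inl rfl)
        · exact Or.inr (Or.inr rfl)
        · omega
      rcases h3 with rfl | rfl | rfl
      · refine ⟨1, 2, fun y hyp hyq => ?_⟩
        have h1 := h (colP (Pi.single 1 1) + colQ (Pi.single 2 1) + y)
        simp [Pi.add_apply, hPp, hPq, hQq, hQp, hyp, hyq] at h1
        exact h1
      · refine ⟨0, 2, fun y hyp hyq => ?_⟩
        have h1 := h (colP (Pi.single 0 1) + colQ (Pi.single 2 1) + y)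
        simp [Pi.add_apply, hPp, hPq, hQq, hQp, hyp, hyq] at h1
        exact h1
      · refine ⟨0, 1, fun y hyp hyq => ?_⟩
        have h1 := h (colP (Pi.single 0 1) + colQ (Pi.single 1 1) + y)
        simp [Pi.add_apply, hPp, hPq, hQq, hQp, hyp, hyq] at h1
        exact h1
    have hy : ∀ (d' : Fin 3) (n' : Fin 4), n' ≠ n →
        (Pi.single d (Pi.single n 1) : Fin 3 → Fin 4 → K) d' n' = 0 := by
      intro d' n' hn'
      simp [Pi.single_apply, ite_apply, hn']
    have h0 := htest 0 (fun d' => by rw [Pi.zero_apply, Pi.zero_apply])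
      (fun d' => by rw [Pi.zero_apply, Pi.zero_apply])
    have h1 := htest (Pi.single d (Pi.single n 1)) (fun d' => hy d' p hnp.symm)
      (fun d' => hy d' q hnq.symm)
    rw [map_zero] at h0
    linear_combination h1 - h0
  -- (5) conclusion: expand `x` in the matrix units
  intro a
  ext d n
  -- `ℓ a (Pi.single d (Pi.single n 1)) = 0`
  simp only [LinearMap.coe_comp, LinearMap.coe_single, Function.comp_apply, LinearMap.zero_comp,
    LinearMap.zero_apply]
  by_cases hnp : n = p
  · subst hnp
    have e : (Pi.single d (Pi.single n 1) : Fin 3 → Fin 4 → K) = colP (Pi.single d 1) := by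
      funext d' n'
      simp only [hP, Pi.single_apply]
      split_ifs <;> simp_all
    rw [e]; exact hA a _
  by_cases hnq : n = q
  · subst hnq
    have e : (Pi.single d (Pi.single n 1) : Fin 3 → Fin 4 → K) = colQ (Pi.single d 1) := by
      funext d' n'
      simp only [hQ, Pi.single_apply]
      split_ifs <;> simp_all
    rw [e]; exact hB a _
  exact hC a d n hnp hnq

/-! ### The toric pencil is trivial -/

/-- **The toric pencil of `per [w; ·]` over the hyperplane `w₃ = 0` is trivial.**  See the module
docstring. [folklore] -/
theorem toric_pencil_eq_zero [CharZero K]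
    (K₀ K₁ K₂ : (Fin 3 → Fin 4 → K) →ₗ[K] (Fin 3 → Fin 4 → K))
    (hI : ∀ w : Fin 4 → K, w 3 = 0 → ∀ (x : Fin 3 → Fin 4 → K) (t : K),
      (Matrix.of ![w, (x + t • (w 0 • K₀ x + w 1 • K₁ x + w 2 • K₂ x)) 0,
        (x + t • (w 0 • K₀ x + w 1 • K₁ x + w 2 • K₂ x)) 1,
        (x + t • (w 0 • K₀ x + w 1 • K₁ x + w 2 • K₂ x)) 2]).permanent =
      (Matrix.of ![w, x 0, x 1, x 2]).permanent) :
    K₀ = 0 ∧ K₁ = 0 ∧ K₂ = 0 := by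
  classical
  -- Stage 1: column supports
  have s0 : ∀ x a m, m ≠ 0 → K₀ x a m = 0 := by
    refine col_support_of_pencil 0 K₀ fun x t => ?_
    have h := hI (Pi.single 0 1) (by simp) x t
    simpa using h
  have s1 : ∀ x a m, m ≠ 1 → K₁ x a m = 0 := by
    refine col_support_of_pencil 1 K₁ fun x t => ?_
    have h := hI (Pi.single 1 1) (by simp) x t
    simpa using h
  have s2 : ∀ x a m, m ≠ 2 → K₂ x a m = 0 := by
    refine col_support_of_pencil 2 K₂ fun x t => ?_
    have h := hI (Pi.single 2 1) (by simp) x t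
    simpa using h
  have hK0f : ∀ x, K₀ x = fun a m => if m = 0 then K₀ x a 0 else 0 := fun x => by
    funext a m
    by_cases hm : m = 0
    · subst hm; rw [if_pos rfl]
    · rw [if_neg hm]; exact s0 x a m hm
  have hK1f : ∀ x, K₁ x = fun a m => if m = 1 then K₁ x a 1 else 0 := fun x => by
    funext a m
    by_cases hm : m = 1
    · subst hm; rw [if_pos rfl]
    · rw [if_neg hm]; exact s1 x a m hm
  have hK2f : ∀ x, K₂ x = fun a m => if m = 2 then K₂ x a 2 else 0 := fun x => by
    funext a m
    by_cases hm : m = 2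
    · subst hm; rw [if_pos rfl]
    · rw [if_neg hm]; exact s2 x a m hm
  -- Stage 2: the three pairs
  have S01 : ∀ x : Fin 3 → Fin 4 → K,
      (K₀ x 0 0 + K₁ x 0 1) * (x 1 2 * x 2 3 + x 1 3 * x 2 2) +
        (K₀ x 1 0 + K₁ x 1 1) * (x 0 2 * x 2 3 + x 0 3 * x 2 2) +
        (K₀ x 2 0 + K₁ x 2 1) * (x 0 2 * x 1 3 + x 0 3 * x 1 2) = 0 := by
    intro x
    have h := hI (Pi.single 0 1 + Pi.single 1 1) (by simp) x 1
    rw [hK0f x, hK1f x, hK2f x] at h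
    simp [permanent_of_rows] at h
    linear_combination h
  have S02 : ∀ x : Fin 3 → Fin 4 → K,
      (K₀ x 0 0 + K₂ x 0 2) * (x 1 1 * x 2 3 + x 1 3 * x 2 1) +
        (K₀ x 1 0 + K₂ x 1 2) * (x 0 1 * x 2 3 + x 0 3 * x 2 1) +
        (K₀ x 2 0 + K₂ x 2 2) * (x 0 1 * x 1 3 + x 0 3 * x 1 1) = 0 := by
    intro x
    have h := hI (Pi.single 0 1 + Pi.single 2 1) (by simp) x 1
    rw [hK0f x, hK1f x, hK2f x] at h
    simp [permanent_of_rows] at h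
    linear_combination h
  have S12 : ∀ x : Fin 3 → Fin 4 → K,
      (K₁ x 0 1 + K₂ x 0 2) * (x 1 0 * x 2 3 + x 1 3 * x 2 0) +
        (K₁ x 1 1 + K₂ x 1 2) * (x 0 0 * x 2 3 + x 0 3 * x 2 0) +
        (K₁ x 2 1 + K₂ x 2 2) * (x 0 0 * x 1 3 + x 0 3 * x 1 0) = 0 := by
    intro x
    have h := hI (Pi.single 1 1 + Pi.single 2 1) (by simp) x 1
    rw [hK0f x, hK1f x, hK2f x] at h
    simp [permanent_of_rows] at h
    linear_combination h
  -- the syzygy lemma kills the three sums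
  let pr : Fin 4 → Fin 3 → ((Fin 3 → Fin 4 → K) →ₗ[K] (Fin 3 → Fin 4 → K)) →
      ((Fin 3 → Fin 4 → K) →ₗ[K] K) := fun m a L =>
    (LinearMap.proj m : (Fin 4 → K) →ₗ[K] K) ∘ₗ
      (LinearMap.proj a : (Fin 3 → Fin 4 → K) →ₗ[K] (Fin 4 → K)) ∘ₗ L
  have hpr : ∀ m a L x, pr m a L x = L x a m := fun _ _ _ _ => rfl
  have T01 : ∀ x a, K₀ x a 0 + K₁ x a 1 = 0 := by
    have key := no_linear_syzygy 2 3 (by decide) (fun a => pr 0 a K₀ + pr 1 a K₁) fun x => by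
      simp only [LinearMap.add_apply, hpr]
      exact S01 x
    intro x a
    have h := LinearMap.congr_fun (key a) x
    simpa only [LinearMap.add_apply, hpr, LinearMap.zero_apply] using h
  have T02 : ∀ x a, K₀ x a 0 + K₂ x a 2 = 0 := by
    have key := no_linear_syzygy 1 3 (by decide) (fun a => pr 0 a K₀ + pr 2 a K₂) fun x => by
      simp only [LinearMap.add_apply, hpr]
      exact S02 x
    intro x a
    have h := LinearMap.congr_fun (key a) x
    simpa only [LinearMap.add_apply, hpr, LinearMap.zero_apply] using h
  have T12 : ∀ x a, K₁ x a 1 + K₂ x a 2 = 0 := by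
    have key := no_linear_syzygy 0 3 (by decide) (fun a => pr 1 a K₁ + pr 2 a K₂) fun x => by
      simp only [LinearMap.add_apply, hpr]
      exact S12 x
    intro x a
    have h := LinearMap.congr_fun (key a) x
    simpa only [LinearMap.add_apply, hpr, LinearMap.zero_apply] using h
  -- conclusion
  refine ⟨?_, ?_, ?_⟩
  · apply LinearMap.ext; intro x; funext a m
    by_cases hm : m = 0
    · subst hm
      rw [LinearMap.zero_apply, Pi.zero_apply, Pi.zero_apply]
      linear_combination (T01 x a + T02 x a - T12 x a) / 2
    · rw [LinearMap.zero_apply, Pi.zero_apply, Pi.zero_apply]; exact s0 x a m hm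
  · apply LinearMap.ext; intro x; funext a m
    by_cases hm : m = 1
    · subst hm
      rw [LinearMap.zero_apply, Pi.zero_apply, Pi.zero_apply]
      linear_combination (T01 x a + T12 x a - T02 x a) / 2
    · rw [LinearMap.zero_apply, Pi.zero_apply, Pi.zero_apply]; exact s1 x a m hm
  · apply LinearMap.ext; intro x; funext a m
    by_cases hm : m = 2
    · subst hm
      rw [LinearMap.zero_apply, Pi.zero_apply, Pi.zero_apply]
      linear_combination (T02 x a + T12 x a - T01 x a) / 2
    · rw [LinearMap.zero_apply, Pi.zero_apply, Pi.zero_apply]; exact s2 x a m hm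

end Summit.ValiantsHypothesis.ValiantsHypothesis.Theorems.SymPencilPerFourToricPairs

end
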